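import Mathlib

/-!
# `FigureEightIsTwoSmyth`: the two substitutions of the post-Jensen chain (helper, calculus only)

Item stmt-KontsevichZagierPeriods-5203 of route K2SymbolChains. After the Jensen step, the
figure-eight side is the unfolded representation of `∫_{T_A} log L₊(θ)² dθ` (`L₊` the root of
larger modulus of `L² − gL + 1`, `g = 2cos 4θ − 2cos 2θ − 2 = 4C² − 2C − 4`, `C = cos 2θ`) and the
Smyth side that of `2∫_{|ψ|<π/3} log (4cos ψ)² dψ`. On the arc `0 < θ < π/3` the two angles are
related through `C = cos 2θ`: `θ ↦ C` is the substitution `C(t) = 2c(t)² − 1`, `c(t) = (1−t²)/(1+t²)`,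
`t = tan(θ/2) ∈ (0, 1/√3)`, and `ψ ↦ C` is the ALGEBRAIC substitution
`Φ(x) = ¼ − ¼·x·R(x)`, `R(x) = √((15 − x²)/(1 + x²))`, `x = tan ψ ∈ (−√3, √3)`
(geometrically: `x = 2 Im w` for the shape `w`, `Re w = ½`, of the second ideal tetrahedron of the
figure-eight complement along Boyd's path; `cos(arg z) = 1/(4 cos ψ)` for the first shape `z`).
This file proves the real-variable facts about `C` and `Φ` consumed by the change-of-variables
moves (rule 2) of the chain: derivatives, strict monotonicity, images of the intervals, and the
two transport identities per map — the fibre bound `L₊(g(Φ(x)))² = 16/(1+x²)²` (resp.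
`g(C(t)) = 16c⁴ − 20c² + 2`) and the Jacobian identity
`|Φ'(x)|/(2√(1 − Φ(x)²)) = (1 − x/R(x))/(2(1+x²))` (resp. `|C'(t)|/(2√(1−C(t)²)) = 2/(1+t²)`),
whose even part `1/(2(1+x²))` is the Smyth weight and whose odd part integrates to zero.
Mathlib only; no definitions.
-/

-- single-conjunct summit: Sub = Summit, so the namespace segment repeats by design (CONVENTIONS §2)
set_option linter.dupNamespace false

noncomputable section

open Set Real

namespace Summit.KontsevichZagierPeriods.KontsevichZagierPeriods.Theorems

/-! ### The substitution `C(t) = 2c(t)² − 1 = cos 2θ` on the arc `0 < t < 1/√3` -/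

/-- `g = 4C² − 2C − 4` with `C = 2c² − 1`: `2cos 4θ − 2cos 2θ − 2` in terms of `cos 2θ` and of
`cos θ`. [folklore] -/
theorem torusG_eq_of_cosTwo (c : ℝ) :
    4 * (2 * c ^ 2 - 1) ^ 2 - 2 * (2 * c ^ 2 - 1) - 4 = 16 * c ^ 4 - 20 * c ^ 2 + 2 := by ring

/-- The derivative of `C(t) = 2((1−t²)/(1+t²))² − 1`: `C'(t) = −16t(1−t²)/(1+t²)³`. [folklore] -/
theorem hasDerivAt_cosTwo (t : ℝ) :
    HasDerivAt (fun t : ℝ => 2 * ((1 - t ^ 2) / (1 + t ^ 2)) ^ 2 - 1)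
      (-(16 * t * (1 - t ^ 2) / (1 + t ^ 2) ^ 3)) t := by
  have h1 : (1 + t ^ 2 : ℝ) ≠ 0 := by positivity
  have hc : HasDerivAt (fun t : ℝ => (1 - t ^ 2) / (1 + t ^ 2))
      (((-(2 * t)) * (1 + t ^ 2) - (1 - t ^ 2) * (2 * t)) / (1 + t ^ 2) ^ 2) t := by
    have hn : HasDerivAt (fun t : ℝ => 1 - t ^ 2) (-(2 * t)) t := by
      simpa using (hasDerivAt_pow 2 t).const_sub 1
    have hd : HasDerivAt (fun t : ℝ => 1 + t ^ 2) (2 * t) t := by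
      simpa using (hasDerivAt_pow 2 t).const_add 1
    exact hn.div hd h1
  have h := ((hc.pow 2).const_mul 2).sub_const 1
  refine h.congr_deriv ?_
  simp only [Nat.cast_ofNat, Nat.add_one_sub_one, pow_one]
  field_simp
  ring

/-- `C` is strictly decreasing on `[0, 1]` (`C' < 0` inside). [folklore] -/
theorem strictAntiOn_cosTwo :
    StrictAntiOn (fun t : ℝ => 2 * ((1 - t ^ 2) / (1 + t ^ 2)) ^ 2 - 1) (Icc 0 1) := by
  refine strictAntiOn_of_deriv_neg (convex_Icc 0 1) ?_ fun t ht => ?_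
  · exact HasDerivAt.continuousOn fun t _ => hasDerivAt_cosTwo t
  · rw [interior_Icc] at ht
    rw [(hasDerivAt_cosTwo t).deriv]
    have h1 : 0 < 1 - t ^ 2 := by nlinarith [ht.1, ht.2]
    have h2 : 0 < 16 * t * (1 - t ^ 2) / (1 + t ^ 2) ^ 3 := by
      have := ht.1; positivity
    linarith

/-- `C(0) = 1`. [folklore] -/
theorem cosTwo_zero : (2 * ((1 - (0:ℝ) ^ 2) / (1 + (0:ℝ) ^ 2)) ^ 2 - 1) = 1 := by norm_num

/-- `C(1/√3) = −1/2` (`θ = π/3`). [folklore] -/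
theorem cosTwo_inv_sqrt_three :
    (2 * ((1 - (Real.sqrt 3)⁻¹ ^ 2) / (1 + (Real.sqrt 3)⁻¹ ^ 2)) ^ 2 - 1) = -1 / 2 := by
  have h3 : (Real.sqrt 3) ^ 2 = 3 := Real.sq_sqrt (by norm_num)
  rw [inv_pow, h3]
  norm_num

/-- `0 < 1/√3 < 1`. [folklore] -/
theorem inv_sqrt_three_pos_lt_one : 0 < (Real.sqrt 3)⁻¹ ∧ (Real.sqrt 3)⁻¹ < 1 := by
  have h3 : (1 : ℝ) < Real.sqrt 3 := by
    rw [show (1:ℝ) = Real.sqrt 1 by simp]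
    exact Real.sqrt_lt_sqrt (by norm_num) (by norm_num)
  exact ⟨inv_pos.2 (by linarith), inv_lt_one_of_one_lt₀ h3⟩

/-- **`C` maps the arc `(0, 1/√3)` onto `(−1/2, 1)`** (continuity, intermediate values and strict
monotonicity). [folklore] -/
theorem image_cosTwo_Ioo :
    (fun t : ℝ => 2 * ((1 - t ^ 2) / (1 + t ^ 2)) ^ 2 - 1) '' Ioo 0 (Real.sqrt 3)⁻¹ =
      Ioo (-1 / 2) 1 := by
  obtain ⟨ha0, ha1⟩ := inv_sqrt_three_pos_lt_one
  have hcont : ContinuousOn (fun t : ℝ => 2 * ((1 - t ^ 2) / (1 + t ^ 2)) ^ 2 - 1)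
      (Icc 0 (Real.sqrt 3)⁻¹) := HasDerivAt.continuousOn fun t _ => hasDerivAt_cosTwo t
  have hanti := strictAntiOn_cosTwo.mono (Icc_subset_Icc_right ha1.le)
  apply Subset.antisymm
  · rintro _ ⟨t, ht, rfl⟩
    have htI : t ∈ Icc 0 (Real.sqrt 3)⁻¹ := Ioo_subset_Icc_self ht
    refine ⟨?_, ?_⟩
    · exact (Eq.symm cosTwo_inv_sqrt_three).trans_lt (hanti htI (right_mem_Icc.2 ha0.le) ht.2)
    · exact (hanti (left_mem_Icc.2 ha0.le) htI ht.1).trans_eq cosTwo_zero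
  · have h := intermediate_value_Ioo' ha0.le hcont
    rw [cosTwo_zero, cosTwo_inv_sqrt_three] at h
    exact h

/-- **The Jacobian identity for `C`**: on `0 < t < 1`, `1 − C(t)² = (2c(t)σ(t))²` and
`|C'(t)| = (2/(1+t²)) · 2√(1 − C(t)²)` (`dθ = dC/(2 sin 2θ)`, `sin 2θ = 2cσ`). [folklore] -/
theorem abs_deriv_cosTwo {t : ℝ} (ht0 : 0 < t) (ht1 : t < 1) :
    |(-(16 * t * (1 - t ^ 2) / (1 + t ^ 2) ^ 3))| =
      2 / (1 + t ^ 2) * (2 * Real.sqrt (1 - (2 * ((1 - t ^ 2) / (1 + t ^ 2)) ^ 2 - 1) ^ 2)) := by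
  have h1 : (1 + t ^ 2 : ℝ) ≠ 0 := by positivity
  have hm : 0 < 1 - t ^ 2 := by nlinarith
  have hsq : 1 - (2 * ((1 - t ^ 2) / (1 + t ^ 2)) ^ 2 - 1) ^ 2 =
      (2 * ((1 - t ^ 2) / (1 + t ^ 2)) * (2 * t / (1 + t ^ 2))) ^ 2 := by
    field_simp
    ring
  have hpos : 0 ≤ 2 * ((1 - t ^ 2) / (1 + t ^ 2)) * (2 * t / (1 + t ^ 2)) := by positivity
  rw [hsq, Real.sqrt_sq hpos, abs_of_neg (by
    have : 0 < 16 * t * (1 - t ^ 2) / (1 + t ^ 2) ^ 3 := by positivity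
    linarith)]
  field_simp
  ring

/-- `0 < 1 − C(t)²` on `0 < t < 1` (the arc misses `C = ±1`). [folklore] -/
theorem one_sub_cosTwo_sq_pos {t : ℝ} (ht0 : 0 < t) (ht1 : t < 1) :
    0 < 1 - (2 * ((1 - t ^ 2) / (1 + t ^ 2)) ^ 2 - 1) ^ 2 := by
  have h1 : (1 + t ^ 2 : ℝ) ≠ 0 := by positivity
  have hm : 0 < 1 - t ^ 2 := by nlinarith
  have hsq : 1 - (2 * ((1 - t ^ 2) / (1 + t ^ 2)) ^ 2 - 1) ^ 2 =
      (2 * ((1 - t ^ 2) / (1 + t ^ 2)) * (2 * t / (1 + t ^ 2))) ^ 2 := by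
    field_simp
    ring
  have ht' := ht0
  rw [hsq]
  positivity

/-! ### The algebraic substitution `Φ(x) = ¼ − ¼ x R(x)`, `R = √((15 − x²)/(1 + x²))` -/

/-- `R(x)² = (15 − x²)/(1 + x²)` for `x² ≤ 15`. [folklore] -/
theorem rootR_sq {x : ℝ} (hx : x ^ 2 ≤ 15) :
    Real.sqrt ((15 - x ^ 2) / (1 + x ^ 2)) ^ 2 = (15 - x ^ 2) / (1 + x ^ 2) :=
  Real.sq_sqrt (div_nonneg (by linarith) (by positivity))

/-- `R(x) > |x|` for `x² < 3` (indeed `R² ≥ 3 > x²`), so `x + R > 0` and `R − x > 0`. [folklore] -/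
theorem abs_lt_rootR {x : ℝ} (hx : x ^ 2 < 3) : |x| < Real.sqrt ((15 - x ^ 2) / (1 + x ^ 2)) := by
  rw [← Real.sqrt_sq_eq_abs]
  apply Real.sqrt_lt_sqrt (sq_nonneg x)
  rw [lt_div_iff₀ (by positivity)]
  nlinarith

/-- `R(x) > 0` for `x² < 15`. [folklore] -/
theorem rootR_pos {x : ℝ} (hx : x ^ 2 < 15) : 0 < Real.sqrt ((15 - x ^ 2) / (1 + x ^ 2)) :=
  Real.sqrt_pos.2 (div_pos (by linarith) (by positivity))

/-- **The derivative of `Φ`**, raw form: for `x² < 15`,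
`Φ'(x) = −(R(x) + x · (−32x/(1+x²)²)/(2R(x)))/4`. [folklore] -/
theorem hasDerivAt_phiMap {x : ℝ} (hx : x ^ 2 < 15) :
    HasDerivAt (fun x : ℝ => 1 / 4 - x * Real.sqrt ((15 - x ^ 2) / (1 + x ^ 2)) / 4)
      (-(Real.sqrt ((15 - x ^ 2) / (1 + x ^ 2)) +
        x * ((-(32 * x) / (1 + x ^ 2) ^ 2) / (2 * Real.sqrt ((15 - x ^ 2) / (1 + x ^ 2))))) / 4) x := by
  have h1 : (1 + x ^ 2 : ℝ) ≠ 0 := by positivity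
  have hin : HasDerivAt (fun x : ℝ => (15 - x ^ 2) / (1 + x ^ 2)) (-(32 * x) / (1 + x ^ 2) ^ 2) x := by
    have hn : HasDerivAt (fun x : ℝ => 15 - x ^ 2) (-(2 * x)) x := by
      simpa using (hasDerivAt_pow 2 x).const_sub 15
    have hd : HasDerivAt (fun x : ℝ => 1 + x ^ 2) (2 * x) x := by
      simpa using (hasDerivAt_pow 2 x).const_add 1
    refine (hn.div hd h1).congr_deriv ?_
    ring
  have hne : (15 - x ^ 2) / (1 + x ^ 2) ≠ 0 := (div_pos (by linarith) (by positivity)).ne'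
  have hR := hin.sqrt hne
  have h := (((hasDerivAt_id' x).mul hR).div_const 4).const_sub (1 / 4)
  refine h.congr_deriv ?_
  ring

/-- **The derivative of `Φ`, factored**: the raw derivative equals
`−(3 − x²)(5 + x²)/(4 R(x) (1 + x²)²)`. [folklore] -/
theorem deriv_phiMap_eq {x : ℝ} (hx : x ^ 2 < 15) :
    -(Real.sqrt ((15 - x ^ 2) / (1 + x ^ 2)) +
        x * ((-(32 * x) / (1 + x ^ 2) ^ 2) / (2 * Real.sqrt ((15 - x ^ 2) / (1 + x ^ 2))))) / 4 =
      -((3 - x ^ 2) * (5 + x ^ 2)) / (4 * Real.sqrt ((15 - x ^ 2) / (1 + x ^ 2)) * (1 + x ^ 2) ^ 2) := by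
  have hR := rootR_pos hx
  have hR2 := rootR_sq hx.le
  set R := Real.sqrt ((15 - x ^ 2) / (1 + x ^ 2)) with hRdef
  clear_value R
  have h1 : (1 + x ^ 2 : ℝ) ≠ 0 := by positivity
  have hR' : R ≠ 0 := hR.ne'
  rw [eq_div_iff (by positivity)] at hR2
  field_simp
  linear_combination (-2 * (1 + x ^ 2)) * hR2

/-- `Φ' < 0` on `x² < 3`. [folklore] -/
theorem deriv_phiMap_neg {x : ℝ} (hx : x ^ 2 < 3) :
    -((3 - x ^ 2) * (5 + x ^ 2)) / (4 * Real.sqrt ((15 - x ^ 2) / (1 + x ^ 2)) * (1 + x ^ 2) ^ 2) < 0 := by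
  have hR := rootR_pos (show x ^ 2 < 15 by linarith)
  have hnum : 0 < (3 - x ^ 2) * (5 + x ^ 2) := by nlinarith
  have hden : 0 < 4 * Real.sqrt ((15 - x ^ 2) / (1 + x ^ 2)) * (1 + x ^ 2) ^ 2 := by positivity
  rw [neg_div]
  exact neg_neg_of_pos (div_pos hnum hden)

/-- `Φ` is continuous on `[−√3, √3]`. [folklore] -/
theorem continuousOn_phiMap :
    ContinuousOn (fun x : ℝ => 1 / 4 - x * Real.sqrt ((15 - x ^ 2) / (1 + x ^ 2)) / 4)
      (Icc (-Real.sqrt 3) (Real.sqrt 3)) := by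
  refine HasDerivAt.continuousOn fun x hx => hasDerivAt_phiMap ?_
  have habs : |x| ≤ Real.sqrt 3 := abs_le.2 ⟨hx.1, hx.2⟩
  have : x ^ 2 ≤ 3 := by
    rw [← sq_abs, ← Real.sq_sqrt (show (0:ℝ) ≤ 3 by norm_num)]
    exact pow_le_pow_left₀ (abs_nonneg x) habs 2
  linarith

/-- `Φ` is strictly decreasing on `[−√3, √3]`. [folklore] -/
theorem strictAntiOn_phiMap :
    StrictAntiOn (fun x : ℝ => 1 / 4 - x * Real.sqrt ((15 - x ^ 2) / (1 + x ^ 2)) / 4)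
      (Icc (-Real.sqrt 3) (Real.sqrt 3)) := by
  refine strictAntiOn_of_deriv_neg (convex_Icc _ _) continuousOn_phiMap fun x hx => ?_
  rw [interior_Icc] at hx
  have habs : |x| < Real.sqrt 3 := abs_lt.2 ⟨hx.1, hx.2⟩
  have hx3 : x ^ 2 < 3 := by
    rw [← sq_abs, ← Real.sq_sqrt (show (0:ℝ) ≤ 3 by norm_num)]
    exact pow_lt_pow_left₀ habs (abs_nonneg x) two_ne_zero
  rw [(hasDerivAt_phiMap (by linarith)).deriv, deriv_phiMap_eq (by linarith)]
  exact deriv_phiMap_neg hx3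

/-- `Φ(√3) = −1/2` and `Φ(−√3) = 1` (`R(±√3) = √3`). [folklore] -/
theorem phiMap_sqrt_three :
    (1 / 4 - Real.sqrt 3 * Real.sqrt ((15 - Real.sqrt 3 ^ 2) / (1 + Real.sqrt 3 ^ 2)) / 4 = -1 / 2) ∧
    (1 / 4 - (-Real.sqrt 3) * Real.sqrt ((15 - (-Real.sqrt 3) ^ 2) / (1 + (-Real.sqrt 3) ^ 2)) / 4 = 1) := by
  rw [neg_sq, Real.sq_sqrt (show (0:ℝ) ≤ 3 by norm_num)]
  norm_num

/-- **`Φ` maps `(−√3, √3)` onto `(−1/2, 1)`.** [folklore] -/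
theorem image_phiMap_Ioo :
    (fun x : ℝ => 1 / 4 - x * Real.sqrt ((15 - x ^ 2) / (1 + x ^ 2)) / 4) '' Ioo (-Real.sqrt 3) (Real.sqrt 3) =
      Ioo (-1 / 2) 1 := by
  have hs : -Real.sqrt 3 ≤ Real.sqrt 3 := by
    have := Real.sqrt_nonneg 3; linarith
  obtain ⟨hb, ha⟩ := phiMap_sqrt_three
  apply Subset.antisymm
  · rintro _ ⟨x, hx, rfl⟩
    have hxI : x ∈ Icc (-Real.sqrt 3) (Real.sqrt 3) := Ioo_subset_Icc_self hx
    refine ⟨?_, ?_⟩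
    · exact hb.symm.trans_lt (strictAntiOn_phiMap hxI (right_mem_Icc.2 hs) hx.2)
    · exact (strictAntiOn_phiMap (left_mem_Icc.2 hs) hxI hx.1).trans_eq ha
  · have h := intermediate_value_Ioo' hs continuousOn_phiMap
    rw [ha, hb] at h
    exact h

/-- **Transport of the fibre bound under `Φ`, step 1**: `g(Φ(x)) = 4Φ² − 2Φ − 4 = −(16 + (1+x²)²)/(4(1+x²))`
for `x² ≤ 15`. [folklore] -/
theorem torusG_phiMap {x : ℝ} (hx : x ^ 2 ≤ 15) :
    4 * (1 / 4 - x * Real.sqrt ((15 - x ^ 2) / (1 + x ^ 2)) / 4) ^ 2 -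
        2 * (1 / 4 - x * Real.sqrt ((15 - x ^ 2) / (1 + x ^ 2)) / 4) - 4 =
      -(16 + (1 + x ^ 2) ^ 2) / (4 * (1 + x ^ 2)) := by
  have hR2 := rootR_sq hx
  set R := Real.sqrt ((15 - x ^ 2) / (1 + x ^ 2)) with hRdef
  clear_value R
  have h1 : (1 + x ^ 2 : ℝ) ≠ 0 := by positivity
  rw [eq_div_iff (by positivity)] at hR2
  field_simp
  linear_combination x ^ 2 * hR2

/-- **Transport of the fibre bound under `Φ`, step 2**: for `g = −(16 + p²)/(4p)`, `p = 1 + x²`,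
`x² < 3`, the root `L₊ = (g − √(g² − 4))/2` is `−4/p`, so `L₊² = 16/(1+x²)²` — the Smyth fibre
bound squared. [folklore] -/
theorem rootLp_sq_phiMap {x : ℝ} (hx : x ^ 2 < 3) :
    ((-(16 + (1 + x ^ 2) ^ 2) / (4 * (1 + x ^ 2)) -
        Real.sqrt ((-(16 + (1 + x ^ 2) ^ 2) / (4 * (1 + x ^ 2))) ^ 2 - 4)) / 2) ^ 2 =
      16 / (1 + x ^ 2) ^ 2 := by
  have hp : (0 : ℝ) < 1 + x ^ 2 := by positivity
  have hsq : (-(16 + (1 + x ^ 2) ^ 2) / (4 * (1 + x ^ 2))) ^ 2 - 4 =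
      ((16 - (1 + x ^ 2) ^ 2) / (4 * (1 + x ^ 2))) ^ 2 := by
    field_simp
    ring
  have hnn : 0 ≤ (16 - (1 + x ^ 2) ^ 2) / (4 * (1 + x ^ 2)) :=
    div_nonneg (by nlinarith) (by positivity)
  rw [hsq, Real.sqrt_sq hnn]
  field_simp
  ring

/-- **The Jacobian identity for `Φ`**: for `x² < 3`, `√(1 − Φ(x)²) = (x + R(x))/4` and
`|Φ'(x)| = ((1 − x/R(x))/(2(1+x²))) · 2√(1 − Φ(x)²)` (`dθ/dx = ½(1/(1+x²)) − ½ x/(R(1+x²))`: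
even part the Smyth weight, odd part killed by `x ↦ −x`). [folklore] -/
theorem abs_deriv_phiMap {x : ℝ} (hx : x ^ 2 < 3) :
    |-((3 - x ^ 2) * (5 + x ^ 2)) / (4 * Real.sqrt ((15 - x ^ 2) / (1 + x ^ 2)) * (1 + x ^ 2) ^ 2)| =
      (1 - x / Real.sqrt ((15 - x ^ 2) / (1 + x ^ 2))) / (2 * (1 + x ^ 2)) *
        (2 * Real.sqrt (1 - (1 / 4 - x * Real.sqrt ((15 - x ^ 2) / (1 + x ^ 2)) / 4) ^ 2)) := by
  have hR := rootR_pos (show x ^ 2 < 15 by linarith)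
  have hR2 := rootR_sq (show x ^ 2 ≤ 15 by linarith)
  have hxR := abs_lt_rootR hx
  have hneg := deriv_phiMap_neg hx
  set R := Real.sqrt ((15 - x ^ 2) / (1 + x ^ 2)) with hRdef
  clear_value R
  have hp : (0 : ℝ) < 1 + x ^ 2 := by positivity
  rw [eq_div_iff hp.ne'] at hR2
  have hxR' : 0 < x + R := by linarith [neg_abs_le x]
  have hsq : 1 - (1 / 4 - x * R / 4) ^ 2 = ((x + R) / 4) ^ 2 := by
    linear_combination (-(1:ℝ)/16) * hR2
  have key : (3 - x ^ 2) * (5 + x ^ 2) = (1 + x ^ 2) * (R ^ 2 - x ^ 2) := by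
    linear_combination (-1 : ℝ) * hR2
  have hR' : R ≠ 0 := hR.ne'
  rw [abs_of_neg hneg, hsq, Real.sqrt_sq (by positivity), key]
  field_simp
  ring

/-- `0 < 1 − Φ(x)²` for `x² < 3`. [folklore] -/
theorem one_sub_phiMap_sq_pos {x : ℝ} (hx : x ^ 2 < 3) :
    0 < 1 - (1 / 4 - x * Real.sqrt ((15 - x ^ 2) / (1 + x ^ 2)) / 4) ^ 2 := by
  have hR2 := rootR_sq (show x ^ 2 ≤ 15 by linarith)
  have hxR := abs_lt_rootR hx
  set R := Real.sqrt ((15 - x ^ 2) / (1 + x ^ 2)) with hRdef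
  clear_value R
  have hp : (0 : ℝ) < 1 + x ^ 2 := by positivity
  rw [eq_div_iff hp.ne'] at hR2
  have hxR' : 0 < x + R := by linarith [neg_abs_le x]
  have hsq : 1 - (1 / 4 - x * R / 4) ^ 2 = ((x + R) / 4) ^ 2 := by
    linear_combination (-(1:ℝ)/16) * hR2
  rw [hsq]
  positivity

end Summit.KontsevichZagierPeriods.KontsevichZagierPeriods.Theorems
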